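import Summits.Ventures.Crystal3D.Theorems.StickyWulffConstantCoaxialWallLawDebtTwinRow
import Summits.Ventures.Crystal3D.Theorems.StickyWulffConstantCoaxialWallLawPayerTwinTwoPlateRowGen
import HarnessLib

/-!
# Debt 1 of the vicinal split, `CoaxialTwoSlabAdhesionCoherentTwin`, FROM THE TWIN CENSUS ROW at every version

HONEST FRAMING. Venture `Summits/Ventures/Crystal3D` (cell `crystal3d-full`), helper `--supports` the crux
`CoaxialWallLaw` of `route-Ventures-StickyWulffConstant` (REGISTERED line `WallLedgerF`).  Rung credit; F-C1 not
moved; CONDITIONAL on named facts.  cf-p1 g28 (xxxviii″): `coaxialTwoSlabAdhesionCoherentTwin_of_row` (`…DebtTwinRow`)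
VERBATIM with the twin half-turn rows at version `ver` (`EndRowTwinHalfTurn ver s_F` unfolded) and the rung
`coaxialTwoSlabAdhesion_general_twin_of_row_gen ver`.

* **`coaxialTwoSlabAdhesionCoherentTwin_of_row_gen`** :
  `KissingGap δ → KissingClassification δ → 0 < s_F ≤ 2√6 → (twin half-turn rows, ver, s_F) → CoaxialTwoSlabAdhesionCoherentTwin`.
WHAT THIS IS NOT: not the row; F-C1 not moved.
-/

noncomputable section

namespace Summit.Ventures.Crystal3D.Theorems

open Summit.Ventures.Crystal3D Finset
open Literature.MathematicalPhysics.StatisticalMechanics (fccStacking barlowStacking IsHaggSeq)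
open scoped InnerProductSpace

section Row

variable (ver : WordVersion) {δ : ℝ} (hg : KissingGap δ) (hc : KissingClassification δ)
variable {sF : ℝ} (hsF : 0 < sF) (hsF' : sF ≤ 2 * Real.sqrt 6)
include hg hc hsF hsF'

open scoped Classical in
/-- **Debt 1 from the twin row at version `ver`.**  See the module docstring. -/
theorem coaxialTwoSlabAdhesionCoherentTwin_of_row_gen (hrowW : EndRowTwinHalfTurn ver sF) :
    CoaxialTwoSlabAdhesionCoherentTwin := by
  intro A₁ t₁ A₂ t₂ hcoax hne hS
  obtain ⟨-, ν, hν1, hmenu, hA₂, -⟩ := hS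
  have htwin : A₁ '' fccStacking 1 (Real.sqrt (2 / 3)) ≠ A₂ '' fccStacking 1 (Real.sqrt (2 / 3)) := by
    rw [hA₂]; exact image_ne_twinFrame A₁ hν1 hmenu
  obtain ⟨L, s₁, s₂, σ, σ', hσ, hσ', hsub₁, hsub₂⟩ := hcoax
  set e₃ : EuclideanSpace ℝ (Fin 3) := EuclideanSpace.single (2 : Fin 3) (1 : ℝ) with he₃
  have hRR : ∀ L' : EuclideanSpace ℝ (Fin 3) ≃ₗᵢ[ℝ] EuclideanSpace ℝ (Fin 3),
      ((ℝ ∙ e₃).reflection).trans (((ℝ ∙ e₃).reflection).trans L') = L' := fun L' =>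
    LinearIsometryEquiv.ext fun x => by
      simp only [LinearIsometryEquiv.trans_apply, Submodule.reflection_reflection]
  have hrow : ∀ F : Bool → (EuclideanSpace ℝ (Fin 3) ≃ₗᵢ[ℝ] EuclideanSpace ℝ (Fin 3)),
      (F false = L ∧ F true = ((ℝ ∙ e₃).reflection).trans L ∨
        F false = ((ℝ ∙ e₃).reflection).trans L ∧ F true = L) →
      LocalEndRow ver sF ⟨F false, inPlaneRoots (F false) 1⟩ ⟨F true, inPlaneRoots (F true) (-1)⟩ := by
    rintro F (⟨h0, h1⟩ | ⟨h0, h1⟩)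
    · rw [h0, h1]; exact hrowW L
    · have := hrowW (((ℝ ∙ e₃).reflection).trans L)
      rw [hRR] at this
      rw [h0, h1]; exact this
  obtain ⟨C, R₀, hR₀, hmain⟩ := coaxialTwoSlabAdhesion_general_twin_of_row_gen ver hg hc A₁ t₁ A₂ t₂ L s₁ s₂ σ σ'
    hσ hσ' hsub₁ hsub₂ htwin hsF hsF' hrow
  exact ⟨L, s₁, s₂, σ, σ', hσ, hσ', hsub₁, hsub₂, C, R₀, hR₀, hmain⟩

end Row

end Summit.Ventures.Crystal3D.Theorems

end
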